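import Literature.Geometry.Kaehler.ComplexTorusHodgeLieAlgebraRatProductSolvableFactor
import Literature.Geometry.Kaehler.ComplexTorusHodgeLieAlgebraRatProductNoCommonFactor
import HarnessLib

/-!
# The rational Hodge Lie algebra of a product INTERTWINES the homomorphisms: `P C₁₁ = C₂₂ P` for `C ∈ 𝒜(X₁ × X₂)`,
# `P ∈ Hom_ℚ(X₁, X₂)`; `Hom_ℚ(X₁, X₂) ≠ 0 ⟹ Hg(X₁ × X₂) ≠ Hg(X₁) × Hg(X₂)`; Imai's «`Hg(E₁ × E₂) = {(x, λxλ⁻¹)}`» OVER `ℚ`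
# for ISOGENOUS complex tori: `𝒜(X₁ × X₂) = {(A, PAP⁻¹) | A ∈ 𝒜(X₁)} ≅ 𝒜(X₁)`; embedded and quotient factors

Layer `Literature/Geometry/Kaehler`, namespace `Literature.Geometry.Kaehler.ComplexTorus`; lane `lit-hodgefound` (Track 2
foundations library), Layer A3/A4; prover seat `lit-hodgefound-p17` (generation 42, self-proposed row g42-#4), sequel of g42-#1
`ComplexTorusHodgeLieAlgebraRatProductGoursat` (block projections of `𝒜(X₁ × X₂)` onto over `ℚ`; the one-sided splitting tests),
g42-#2 `…SolvableFactor` and g42-#3 `…NoCommonFactor` (used for the «no homomorphisms» corollaries), with p36's rational plumbing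
(`𝒜 ⊆ C(End⁰)`: `coe_hodgeGroupLieRat_subset_centralizer_endAlgRat`; `End_ℚ(X₁ × X₂)` in block form:
`fromBlocks_mem_endAlgRat_prod_iff` of `ComplexTorusEndomorphismAlgebraProduct`; `J ∈ 𝔥𝔤_ℝ`: p40's `jMatrix_mem_hodgeGroupLie`;
isogenies invertible in `Hom_ℚ`: `IsIsogeny.exists_homRat_inverse`).  THEOREMS ONLY (no definition, no instance, no notation, no
named fact; D-0026 net debt 0).

THE MECHANISM.  `Hom_ℚ(X₁, X₂) = homRat Φ₁ Φ₂ ⊆ M_{ι₂ × ι₁}(ℚ)` sits in `End_ℚ(X₁ × X₂)` as the corner `(0 0; P 0)`; the rational Hodge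
Lie algebra commutes with `End_ℚ` (the endomorphisms are Hodge classes: Lange 7.2.5 at the Lie algebra, over `ℚ`), and
`C = (C₁₁ 0; 0 C₂₂)`, so `(0 0; P 0)(C₁₁ 0; 0 C₂₂) = (C₁₁ 0; 0 C₂₂)(0 0; P 0)` reads `P C₁₁ = C₂₂ P`.  With an INVERTIBLE `P` (an
isogeny) `C₂₂ = P C₁₁ P⁻¹` is determined by `C₁₁` and the onto projection `r₁` is an isomorphism `𝒜(X₁ × X₂) ≅ 𝒜(X₁)`; with the
splitting test of g42-#1 (`(A 0; 0 0) ∈ 𝒜(X)` for all `A`), a split product has `P A = 0` for all `A ∈ 𝒜(X₁)`, hence `P J₁ = 0`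
(`J₁ ∈ 𝔥𝔤_ℝ = 𝒜(X₁) ⊗ ℝ`) and `P = 0`.

## Sources, verbatim

* [Imai1976HodgeGroups] H. Imai, *On the Hodge groups of some abelian varieties*, Kōdai Math. Sem. Rep. 27 (1976), §3 Remarks
  (held `paper:doi-10-2996-kmj-1138847263`, p. 370 L14–L18): «If `E₁` and `E₂` are isogenous elliptic curves, the Hodge group of
  `E₁ × E₂` is obtained as: `Hg(E₁ × E₂) = {(x, λxλ⁻¹) | x ∈ Hg(E₁)}` where `λ : E₁ → E₂` is an isogeny viewed as a map `V₁ → V₂`».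
* [MoonenZarhin1999LowDim] B. Moonen, Yu. G. Zarhin, Math. Ann. 315 (1999), (0.2)(4) and §1 (held `paper:arxiv-math_9901113` p0002):
  «For `n ≥ 1` we can identify `Hg(Xⁿ)` with `Hg(X)`, acting diagonally on `V_{Xⁿ} = (V_X)ⁿ`. More generally, if `n₁, …, n_r ∈ ℤ_{≥1}`
  then we can identify `Hg(X₁^{n₁} × ⋯ × X_r^{n_r})` with `Hg(X₁ × ⋯ × X_r)`.»; §3 Prop. (3.8) (hypothesis «Suppose `Hom(E,X) = 0`»).
* [Lange2023AbelianVarietiesComplex] H. Lange, *Abelian Varieties over the Complex Numbers* (2023), §7.2.2 Prop. 7.2.5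
  («`End_ℚ(X) ≃ End(V)^{Hg(X)}`»), §2.4.4 Cor. 2.4.26 (proof: block form of `End_ℚ(X₁ × X₂)`), §1.1.2 Prop. 1.1.15 (isogenies are
  invertible in `Hom_ℚ`).
* [GreenGriffithsKerr2012] M. Green, P. Griffiths, M. Kerr, *Mumford–Tate Groups and Domains* (2012), §I.B (I.B.3)–(I.B.4) and
  §III.B (i) («`M_{φ₁+φ₂} ⊂ M_{φ₁} × M_{φ₂}`»).
* [Gordon1997] B. B. Gordon, *A survey of the Hodge conjecture for abelian varieties*, §2.16 Proposition.

## What is proved (arbitrary complex tori)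

* §1 INTERTWINING: **`mul_toBlocks₁₁_eq_toBlocks₂₂_mul_of_mem_homRat`** (`P C₁₁ = C₂₂ P` for `C ∈ 𝒜(X₁ × X₂)`, `P ∈ Hom_ℚ(X₁, X₂)`),
  `mul_toBlocks₂₂_eq_toBlocks₁₁_mul_of_mem_homRat` (`Q C₂₂ = C₁₁ Q`, `Q ∈ Hom_ℚ(X₂, X₁)`).
* §2 HOMOMORPHISMS OBSTRUCT SPLITTING: **`homRat_eq_bot_of_hodgeGroupC_prod_eq_blockDiagProd`** (split ⟹ `Hom_ℚ(X₁, X₂) = 0`) and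
  `homRat_eq_bot_of_hodgeGroupC_prod_eq_blockDiagProd'` (`Hom_ℚ(X₂, X₁) = 0`), **`hodgeGroupC_prod_ne_blockDiagProd_of_mem_homRat_ne_zero`**
  (a non-zero homomorphism ⟹ `Hg(X₁ × X₂) ≠ Hg(X₁) × Hg(X₂)`), `IsIsogenous.hodgeGroupC_prod_ne_blockDiagProd`; consequences with g42-#2 ∕ #3:
  `homRat_eq_bot_of_isSimple_hodgeGroupLieRat_of_isEmpty_lieEquiv` (`ℚ`-simple non-isomorphic `𝒜`'s ⟹ NO HOMOMORPHISMS either way),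
  `IsRiemannForm.homRat_eq_bot_of_forall_mem_endAlgRat_eq_zero_of_isSolvable` (`X₁` polarised with `𝒜(X₁) ∩ End⁰(X₁) = 0`, `𝒜(X₂)`
  solvable ⟹ `Hom_ℚ(X₁, X₂) = 0 = Hom_ℚ(X₂, X₁)`: no CM-type torus maps to or from such an `X₁`).
* §3 ISOGENOUS FACTORS — IMAI'S GRAPH OVER `ℚ`: **`toBlocks₂₂_eq_conj_of_mem_hodgeGroupLieRat_prod`** (`C₂₂ = P C₁₁ Q` for `P ∈ Hom_ℚ(X₁, X₂)`
  with `P Q = 1`), **`mem_hodgeGroupLieRat_prod_iff_of_homRat`** (`C ∈ 𝒜(X₁ × X₂) ⟺ C₁₁ ∈ 𝒜(X₁) ∧ C = (C₁₁ 0; 0 P C₁₁ Q)`),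
  **`coe_hodgeGroupLieRat_prod_eq_image_conj`** (`𝒜(X₁ × X₂) = {(A 0; 0 PAQ) | A ∈ 𝒜(X₁)}`), `fromBlocks_conj_mem_hodgeGroupLieRat_prod`,
  **`nonempty_lieEquiv_hodgeGroupLieRat_prod_of_homRat`** ∕ **`IsIsogenous.nonempty_lieEquiv_hodgeGroupLieRat_prod`** (`r₁ : 𝒜(X₁ × X₂) ≅ 𝒜(X₁)`),
  `IsIsogenous.finrank_hodgeGroupLieRat_prod_eq` (`dim_ℚ 𝒜(X₁ × X₂) = dim_ℚ 𝒜(X₁)`; «`Hg(X × X') = Hg(X)`»).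
* §4 EMBEDDED ∕ QUOTIENT FACTORS (one-sided inverses in `Hom_ℚ`): `toBlocks₁₁_eq_of_mem_hodgeGroupLieRat_prod_of_left_inverse`
  (`Q P = 1` ⟹ `C₁₁ = Q C₂₂ P`), **`nonempty_lieEquiv_hodgeGroupLieRat_prod_right_of_left_inverse`** (`X₁` isogenous onto a subtorus of
  `X₂` — an injective `P ∈ Hom_ℚ(X₁, X₂)` — ⟹ `r₂ : 𝒜(X₁ × X₂) ≅ 𝒜(X₂)`, `𝔤₁(ℚ) = 0`), `finrank_hodgeGroupLieRat_prod_eq_right_of_left_inverse`,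
  and the quotient form **`nonempty_lieEquiv_hodgeGroupLieRat_prod_left_of_right_inverse`** (a surjective `P ∈ Hom_ℚ(X₁, X₂)` ⟹
  `r₁ : 𝒜(X₁ × X₂) ≅ 𝒜(X₁)`), `finrank_hodgeGroupLieRat_prod_eq_left_of_right_inverse`.
-/

noncomputable section

open Matrix Module Function

namespace Literature.Geometry.Kaehler

namespace ComplexTorus

open Literature.NumberTheory.Automorphic (IsAlgebraicSubgroup IsZConnected identityComponent isZConnected_identityComponent
  lieAlgebraGL lieSubalgebraGL)
open Literature.Algebra.Lie

variable {ι₁ ι₂ : Type*} [Fintype ι₁] [Fintype ι₂] [DecidableEq ι₁] [DecidableEq ι₂]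
  {E₁ E₂ : Type*} [NormedAddCommGroup E₁] [NormedSpace ℂ E₁] [NormedAddCommGroup E₂] [NormedSpace ℂ E₂]
  (Φ₁ : (ι₁ → ℝ) ≃L[ℝ] E₁) (Φ₂ : (ι₂ → ℝ) ≃L[ℝ] E₂)

/-! ### §1 `𝒜(X₁ × X₂)` intertwines `Hom_ℚ(X₁, X₂)` and `Hom_ℚ(X₂, X₁)` -/

/-- **`P C₁₁ = C₂₂ P` for `C ∈ 𝒜(X₁ × X₂)` and `P ∈ Hom_ℚ(X₁, X₂)`**: the corner endomorphism `(0 0; P 0) ∈ End_ℚ(X₁ × X₂)` commutes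
with the block-diagonal `C` (`𝒜 ⊆ C(End_ℚ)`, Lange 7.2.5 at the rational Lie algebra). [cite: Lange2023AbelianVarietiesComplex, §7.2.2 Prop. 7.2.5 and §2.4.4 Cor. 2.4.26 (proof)]
[cite: Imai1976HodgeGroups, §3 Remarks] -/
theorem mul_toBlocks₁₁_eq_toBlocks₂₂_mul_of_mem_homRat {C : Matrix (ι₁ ⊕ ι₂) (ι₁ ⊕ ι₂) ℚ}
    (hC : C ∈ hodgeGroupLieRat (prodPeriod Φ₁ Φ₂)) {P : Matrix ι₂ ι₁ ℚ} (hP : P ∈ homRat Φ₁ Φ₂) :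
    P * C.toBlocks₁₁ = C.toBlocks₂₂ * P := by
  have hF : fromBlocks (0 : Matrix ι₁ ι₁ ℚ) 0 P (0 : Matrix ι₂ ι₂ ℚ) ∈ endAlgRat (prodPeriod Φ₁ Φ₂) :=
    (fromBlocks_mem_endAlgRat_prod_iff Φ₁ Φ₂).2
      ⟨Subalgebra.zero_mem _, Submodule.zero_mem _, hP, Subalgebra.zero_mem _⟩
  have hcomm := (Subalgebra.mem_centralizer_iff ℚ).1
    (coe_hodgeGroupLieRat_subset_centralizer_endAlgRat (prodPeriod Φ₁ Φ₂) hC) _ hF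
  rw [eq_fromBlocks_of_mem_hodgeGroupLieRat_prod Φ₁ Φ₂ hC, fromBlocks_multiply, fromBlocks_multiply] at hcomm
  simp only [Matrix.mul_zero, Matrix.zero_mul, add_zero, zero_add, fromBlocks_inj] at hcomm
  exact hcomm.2.2.1

/-- **`Q C₂₂ = C₁₁ Q` for `C ∈ 𝒜(X₁ × X₂)` and `Q ∈ Hom_ℚ(X₂, X₁)`** (the corner `(0 Q; 0 0)`).
[cite: Lange2023AbelianVarietiesComplex, §7.2.2 Prop. 7.2.5 and §2.4.4 Cor. 2.4.26 (proof)] [cite: Imai1976HodgeGroups, §3 Remarks] -/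
theorem mul_toBlocks₂₂_eq_toBlocks₁₁_mul_of_mem_homRat {C : Matrix (ι₁ ⊕ ι₂) (ι₁ ⊕ ι₂) ℚ}
    (hC : C ∈ hodgeGroupLieRat (prodPeriod Φ₁ Φ₂)) {Q : Matrix ι₁ ι₂ ℚ} (hQ : Q ∈ homRat Φ₂ Φ₁) :
    Q * C.toBlocks₂₂ = C.toBlocks₁₁ * Q := by
  have hF : fromBlocks (0 : Matrix ι₁ ι₁ ℚ) Q 0 (0 : Matrix ι₂ ι₂ ℚ) ∈ endAlgRat (prodPeriod Φ₁ Φ₂) :=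
    (fromBlocks_mem_endAlgRat_prod_iff Φ₁ Φ₂).2
      ⟨Subalgebra.zero_mem _, hQ, Submodule.zero_mem _, Subalgebra.zero_mem _⟩
  have hcomm := (Subalgebra.mem_centralizer_iff ℚ).1
    (coe_hodgeGroupLieRat_subset_centralizer_endAlgRat (prodPeriod Φ₁ Φ₂) hC) _ hF
  rw [eq_fromBlocks_of_mem_hodgeGroupLieRat_prod Φ₁ Φ₂ hC, fromBlocks_multiply, fromBlocks_multiply] at hcomm
  simp only [Matrix.mul_zero, Matrix.zero_mul, add_zero, zero_add, fromBlocks_inj] at hcomm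
  exact hcomm.2.1

/-! ### §2 Homomorphisms obstruct the splitting: `Hg(X₁ × X₂) = Hg(X₁) × Hg(X₂) ⟹ Hom_ℚ(X₁, X₂) = 0 = Hom_ℚ(X₂, X₁)` -/

omit [Fintype ι₁] [Fintype ι₂] [DecidableEq ι₁] [DecidableEq ι₂] in
/-- `(A B) ⊗ 1 = (A ⊗ 1)(B ⊗ 1)` (rectangular). [folklore] -/
private theorem map_ratCast_mul {m n o : Type*} [Fintype n] (A : Matrix m n ℚ) (B : Matrix n o ℚ) :
    (A * B).map ((↑) : ℚ → ℝ) = A.map ((↑) : ℚ → ℝ) * B.map ((↑) : ℚ → ℝ) := by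
  rw [show ((↑) : ℚ → ℝ) = (Rat.castHom ℝ : ℚ → ℝ) from rfl, Matrix.map_mul]

/-- `P A = 0` for all `A ∈ 𝒜(X₁)` forces `P = 0`: `𝔥𝔤_ℝ = 𝒜 ⊗ ℝ` contains the invertible `J₁`. [cite: Lange2023AbelianVarietiesComplex, §7.3.1, proof of Prop. 7.3.2 ("containing `J`")]
[cite: GreenGriffithsKerr2012, §II.C, Lemma after (II.C.1)] -/
private theorem eq_zero_of_forall_hodgeGroupLieRat_mul_eq_zero {κ : Type*} {P : Matrix κ ι₁ ℚ}
    (h : ∀ A ∈ hodgeGroupLieRat Φ₁, P * A = 0) : P = 0 := by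
  -- `(P ⊗ 1) X = 0` on `𝔥𝔤_ℝ = span_ℝ (𝒜 ⊗ 1)`
  have h' : ∀ X ∈ hodgeGroupLie Φ₁, P.map ((↑) : ℚ → ℝ) * X = 0 := by
    intro X hX
    rw [mem_hodgeGroupLie_iff_mem_span_hodgeGroupLieRat] at hX
    induction hX using Submodule.span_induction with
    | mem Y hY =>
      obtain ⟨A, hA, rfl⟩ := hY
      show P.map ((↑) : ℚ → ℝ) * A.map ((↑) : ℚ → ℝ) = 0
      rw [← map_ratCast_mul, h A hA, Matrix.map_zero _ Rat.cast_zero]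
    | zero => rw [Matrix.mul_zero]
    | add Y Z _ _ hY hZ => rw [Matrix.mul_add, hY, hZ, add_zero]
    | smul c Y _ hY => rw [Matrix.mul_smul, hY, smul_zero]
  have hJ := h' _ (jMatrix_mem_hodgeGroupLie (Φ := Φ₁))
  have hP : P.map ((↑) : ℚ → ℝ) = 0 := by
    have h2 := congrArg (· * jMatrix Φ₁) hJ
    simp only [Matrix.mul_assoc, jMatrix_mul_jMatrix, Matrix.zero_mul, Matrix.mul_neg, Matrix.mul_one, neg_eq_zero] at h2
    exact h2
  ext i j
  have hij := congrFun (congrFun hP i) j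
  simpa using hij

/-- `A Q = 0` for all `A ∈ 𝒜(X₁)` forces `Q = 0` (`J₁ (Q ⊗ 1) = 0`, `J₁² = -1`). [cite: Lange2023AbelianVarietiesComplex, §7.3.1, proof of Prop. 7.3.2]
[cite: GreenGriffithsKerr2012, §II.C, Lemma after (II.C.1)] -/
private theorem eq_zero_of_forall_mul_hodgeGroupLieRat_eq_zero {κ : Type*} {Q : Matrix ι₁ κ ℚ}
    (h : ∀ A ∈ hodgeGroupLieRat Φ₁, A * Q = 0) : Q = 0 := by
  have h' : ∀ X ∈ hodgeGroupLie Φ₁, X * Q.map ((↑) : ℚ → ℝ) = 0 := by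
    intro X hX
    rw [mem_hodgeGroupLie_iff_mem_span_hodgeGroupLieRat] at hX
    induction hX using Submodule.span_induction with
    | mem Y hY =>
      obtain ⟨A, hA, rfl⟩ := hY
      show A.map ((↑) : ℚ → ℝ) * Q.map ((↑) : ℚ → ℝ) = 0
      rw [← map_ratCast_mul, h A hA, Matrix.map_zero _ Rat.cast_zero]
    | zero => rw [Matrix.zero_mul]
    | add Y Z _ _ hY hZ => rw [Matrix.add_mul, hY, hZ, add_zero]
    | smul c Y _ hY => rw [Matrix.smul_mul, hY, smul_zero]
  have hJ := h' _ (jMatrix_mem_hodgeGroupLie (Φ := Φ₁))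
  have hQ : Q.map ((↑) : ℚ → ℝ) = 0 := by
    have h2 := congrArg (jMatrix Φ₁ * ·) hJ
    simp only [← Matrix.mul_assoc, jMatrix_mul_jMatrix, Matrix.mul_zero, Matrix.neg_mul, Matrix.one_mul, neg_eq_zero] at h2
    exact h2
  ext i j
  have hij := congrFun (congrFun hQ i) j
  simpa using hij

/-- **`Hg(X₁ × X₂)(ℂ) = Hg(X₁)(ℂ) × Hg(X₂)(ℂ) ⟹ Hom_ℚ(X₁, X₂) = 0`**: a split product has `(A 0; 0 0) ∈ 𝒜(X₁ × X₂)` for every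
`A ∈ 𝒜(X₁)` (g42-#1), so `P A = 0 · P = 0` for every `P ∈ Hom_ℚ(X₁, X₂)`, and `P = 0` because `J₁ ∈ 𝒜(X₁) ⊗ ℝ` is invertible —
Moonen–Zarhin's standing hypothesis «`Hom(E, X) = 0`» is NECESSARY for `Hg(X × E) = Hg(X) × Hg(E)`.
[cite: MoonenZarhin1999LowDim, §3 Prop. (3.8) ("Suppose `Hom(E,X) = 0`")] [cite: Imai1976HodgeGroups, §3 Remarks] [cite: Lange2023AbelianVarietiesComplex, §7.2.2 Prop. 7.2.5] -/
theorem homRat_eq_bot_of_hodgeGroupC_prod_eq_blockDiagProd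
    (h : hodgeGroupC (prodPeriod Φ₁ Φ₂) = blockDiagProd (hodgeGroupC Φ₁) (hodgeGroupC Φ₂)) : homRat Φ₁ Φ₂ = ⊥ := by
  rw [eq_bot_iff]
  intro P hP
  rw [Submodule.mem_bot]
  refine eq_zero_of_forall_hodgeGroupLieRat_mul_eq_zero Φ₁ fun A hA ↦ ?_
  have hmem := (hodgeGroupC_prod_eq_blockDiagProd_iff_forall_fromBlocks_zero_mem Φ₁ Φ₂).1 h A hA
  have hint := mul_toBlocks₁₁_eq_toBlocks₂₂_mul_of_mem_homRat Φ₁ Φ₂ hmem hP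
  rwa [toBlocks_fromBlocks₁₁, toBlocks_fromBlocks₂₂, Matrix.zero_mul] at hint

/-- **`Hg(X₁ × X₂)(ℂ) = Hg(X₁)(ℂ) × Hg(X₂)(ℂ) ⟹ Hom_ℚ(X₂, X₁) = 0`.** [cite: MoonenZarhin1999LowDim, §3 Prop. (3.8)] [cite: Imai1976HodgeGroups, §3 Remarks] -/
theorem homRat_eq_bot_of_hodgeGroupC_prod_eq_blockDiagProd'
    (h : hodgeGroupC (prodPeriod Φ₁ Φ₂) = blockDiagProd (hodgeGroupC Φ₁) (hodgeGroupC Φ₂)) : homRat Φ₂ Φ₁ = ⊥ := by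
  rw [eq_bot_iff]
  intro Q hQ
  rw [Submodule.mem_bot]
  refine eq_zero_of_forall_mul_hodgeGroupLieRat_eq_zero Φ₁ fun A hA ↦ ?_
  have hmem := (hodgeGroupC_prod_eq_blockDiagProd_iff_forall_fromBlocks_zero_mem Φ₁ Φ₂).1 h A hA
  have hint := mul_toBlocks₂₂_eq_toBlocks₁₁_mul_of_mem_homRat Φ₁ Φ₂ hmem hQ
  rw [toBlocks_fromBlocks₁₁, toBlocks_fromBlocks₂₂, Matrix.mul_zero] at hint
  exact hint.symm

/-- **A NON-ZERO HOMOMORPHISM `X₁ → X₂` FORCES `Hg(X₁ × X₂) ≠ Hg(X₁) × Hg(X₂)`.** [cite: MoonenZarhin1999LowDim, §3 Prop. (3.8)]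
[cite: Imai1976HodgeGroups, §3 Remarks] -/
theorem hodgeGroupC_prod_ne_blockDiagProd_of_mem_homRat_ne_zero {P : Matrix ι₂ ι₁ ℚ} (hP : P ∈ homRat Φ₁ Φ₂) (hP0 : P ≠ 0) :
    hodgeGroupC (prodPeriod Φ₁ Φ₂) ≠ blockDiagProd (hodgeGroupC Φ₁) (hodgeGroupC Φ₂) := by
  intro h
  have hb := homRat_eq_bot_of_hodgeGroupC_prod_eq_blockDiagProd Φ₁ Φ₂ h
  rw [hb, Submodule.mem_bot] at hP
  exact hP0 hP

/-- **A NON-ZERO HOMOMORPHISM `X₂ → X₁` FORCES `Hg(X₁ × X₂) ≠ Hg(X₁) × Hg(X₂)`.** [cite: MoonenZarhin1999LowDim, §3 Prop. (3.8)]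
[cite: Imai1976HodgeGroups, §3 Remarks] -/
theorem hodgeGroupC_prod_ne_blockDiagProd_of_mem_homRat_ne_zero' {Q : Matrix ι₁ ι₂ ℚ} (hQ : Q ∈ homRat Φ₂ Φ₁) (hQ0 : Q ≠ 0) :
    hodgeGroupC (prodPeriod Φ₁ Φ₂) ≠ blockDiagProd (hodgeGroupC Φ₁) (hodgeGroupC Φ₂) := by
  intro h
  have hb := homRat_eq_bot_of_hodgeGroupC_prod_eq_blockDiagProd' Φ₁ Φ₂ h
  rw [hb, Submodule.mem_bot] at hQ
  exact hQ0 hQ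

variable {Φ₁ Φ₂} in
/-- **ISOGENOUS FACTORS OF POSITIVE DIMENSION NEVER SPLIT**: `X₁ ∼ X₂`, `ι₁ ≠ ∅ ⟹ Hg(X₁ × X₂)(ℂ) ≠ Hg(X₁)(ℂ) × Hg(X₂)(ℂ)`.
[cite: Imai1976HodgeGroups, §3 Remarks] [cite: MoonenZarhin1999LowDim, §1 ("we can identify `Hg(Xⁿ)` with `Hg(X)`")] -/
theorem IsIsogenous.hodgeGroupC_prod_ne_blockDiagProd [Nonempty ι₁] (hiso : IsIsogenous Φ₁ Φ₂) :
    hodgeGroupC (prodPeriod Φ₁ Φ₂) ≠ blockDiagProd (hodgeGroupC Φ₁) (hodgeGroupC Φ₂) := by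
  obtain ⟨A, hA⟩ := hiso
  obtain ⟨Q, -, hQA, -⟩ := hA.exists_homRat_inverse
  refine hodgeGroupC_prod_ne_blockDiagProd_of_mem_homRat_ne_zero Φ₁ Φ₂ hA.map_intCast_mem_homRat fun h0 ↦ ?_
  rw [h0, Matrix.mul_zero] at hQA
  exact one_ne_zero (α := Matrix ι₁ ι₁ ℚ) hQA.symm

/-- **`ℚ`-SIMPLE, NON-`ℚ`-ISOMORPHIC `𝒜(X₁)`, `𝒜(X₂)` ⟹ NO HOMOMORPHISMS: `Hom_ℚ(X₁, X₂) = 0` and `Hom_ℚ(X₂, X₁) = 0`** (the product splits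
by g42-#3). [cite: Gordon1997, §2.16 Proposition] [cite: Imai1976HodgeGroups, §3 Remarks] -/
theorem homRat_eq_bot_of_isSimple_hodgeGroupLieRat_of_isEmpty_lieEquiv [LieAlgebra.IsSimple ℚ (hodgeGroupLieRat Φ₁)]
    [LieAlgebra.IsSimple ℚ (hodgeGroupLieRat Φ₂)] (h : IsEmpty (hodgeGroupLieRat Φ₁ ≃ₗ⁅ℚ⁆ hodgeGroupLieRat Φ₂)) :
    homRat Φ₁ Φ₂ = ⊥ ∧ homRat Φ₂ Φ₁ = ⊥ :=
  ⟨homRat_eq_bot_of_hodgeGroupC_prod_eq_blockDiagProd Φ₁ Φ₂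
      (hodgeGroupC_prod_eq_blockDiagProd_of_isSimple_hodgeGroupLieRat_of_isEmpty_lieEquiv Φ₁ Φ₂ h),
    homRat_eq_bot_of_hodgeGroupC_prod_eq_blockDiagProd' Φ₁ Φ₂
      (hodgeGroupC_prod_eq_blockDiagProd_of_isSimple_hodgeGroupLieRat_of_isEmpty_lieEquiv Φ₁ Φ₂ h)⟩

variable {Φ₁} in
/-- **`X₁` POLARISED WITH `𝒜(X₁) ∩ End⁰(X₁) = 0` AND `𝒜(X₂)` SOLVABLE ⟹ `Hom_ℚ(X₁, X₂) = 0 = Hom_ℚ(X₂, X₁)`** (the product splits by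
g42-#2): e.g. no torus with abelian Hodge Lie algebra (CM type) admits a non-zero homomorphism to or from such an `X₁`.
[cite: MoonenZarhin1999LowDim, §3 Lemma (3.6) and Prop. (3.8)] -/
theorem IsRiemannForm.homRat_eq_bot_of_forall_mem_endAlgRat_eq_zero_of_isSolvable {η₁ : E₁ [⋀^Fin 2]→L[ℝ] ℝ}
    (hη₁ : IsRiemannForm Φ₁ η₁) [LieAlgebra.IsSolvable (hodgeGroupLieRat Φ₂)]
    (h0 : ∀ B ∈ hodgeGroupLieRat Φ₁, B ∈ endAlgRat Φ₁ → B = 0) :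
    homRat Φ₁ Φ₂ = ⊥ ∧ homRat Φ₂ Φ₁ = ⊥ :=
  ⟨homRat_eq_bot_of_hodgeGroupC_prod_eq_blockDiagProd Φ₁ Φ₂
      (hη₁.hodgeGroupC_prod_eq_blockDiagProd_of_forall_mem_endAlgRat_eq_zero_of_isSolvable Φ₂ h0),
    homRat_eq_bot_of_hodgeGroupC_prod_eq_blockDiagProd' Φ₁ Φ₂
      (hη₁.hodgeGroupC_prod_eq_blockDiagProd_of_forall_mem_endAlgRat_eq_zero_of_isSolvable Φ₂ h0)⟩

/-! ### §3 Isogenous factors: `𝒜(X₁ × X₂) = {(A 0; 0 P A P⁻¹) | A ∈ 𝒜(X₁)}` (Imai) -/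

/-- **`C₂₂ = P C₁₁ Q`** for `C ∈ 𝒜(X₁ × X₂)`, `P ∈ Hom_ℚ(X₁, X₂)` with a right inverse `Q` (`P Q = 1`; e.g. `P` an isogeny).
[cite: Imai1976HodgeGroups, §3 Remarks ("`Hg(E₁ × E₂) = {(x, λxλ⁻¹)}`")] -/
theorem toBlocks₂₂_eq_conj_of_mem_hodgeGroupLieRat_prod {C : Matrix (ι₁ ⊕ ι₂) (ι₁ ⊕ ι₂) ℚ}
    (hC : C ∈ hodgeGroupLieRat (prodPeriod Φ₁ Φ₂)) {P : Matrix ι₂ ι₁ ℚ} (hP : P ∈ homRat Φ₁ Φ₂) {Q : Matrix ι₁ ι₂ ℚ}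
    (hPQ : P * Q = 1) : C.toBlocks₂₂ = P * C.toBlocks₁₁ * Q := by
  rw [mul_toBlocks₁₁_eq_toBlocks₂₂_mul_of_mem_homRat Φ₁ Φ₂ hC hP, Matrix.mul_assoc, hPQ, Matrix.mul_one]

/-- **`C₁₁ = Q C₂₂ P`** for `C ∈ 𝒜(X₁ × X₂)`, `P ∈ Hom_ℚ(X₁, X₂)` with a left inverse `Q` (`Q P = 1`; e.g. `P` injective — `X₁` isogenous
onto a subtorus of `X₂`). [cite: Imai1976HodgeGroups, §3 Remarks] [cite: MoonenZarhin1999LowDim, §1] -/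
theorem toBlocks₁₁_eq_of_mem_hodgeGroupLieRat_prod_of_left_inverse {C : Matrix (ι₁ ⊕ ι₂) (ι₁ ⊕ ι₂) ℚ}
    (hC : C ∈ hodgeGroupLieRat (prodPeriod Φ₁ Φ₂)) {P : Matrix ι₂ ι₁ ℚ} (hP : P ∈ homRat Φ₁ Φ₂) {Q : Matrix ι₁ ι₂ ℚ}
    (hQP : Q * P = 1) : C.toBlocks₁₁ = Q * C.toBlocks₂₂ * P := by
  rw [Matrix.mul_assoc, ← mul_toBlocks₁₁_eq_toBlocks₂₂_mul_of_mem_homRat Φ₁ Φ₂ hC hP, ← Matrix.mul_assoc, hQP, Matrix.one_mul]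

/-- **IMAI'S DESCRIPTION OVER `ℚ`: `C ∈ 𝒜(X₁ × X₂) ⟺ C₁₁ ∈ 𝒜(X₁) ∧ C = (C₁₁ 0; 0 P C₁₁ Q)`** for mutually inverse `P ∈ Hom_ℚ(X₁, X₂)`, `Q`
(isogenous factors); `⟸` uses the surjectivity of `r₁` over `ℚ` (g42-#1). [cite: Imai1976HodgeGroups, §3 Remarks ("`Hg(E₁ × E₂) = {(x, λxλ⁻¹) | x ∈ Hg(E₁)}`")]
[cite: MoonenZarhin1999LowDim, (0.2)(4) and §1] -/
theorem mem_hodgeGroupLieRat_prod_iff_of_homRat {P : Matrix ι₂ ι₁ ℚ} (hP : P ∈ homRat Φ₁ Φ₂) {Q : Matrix ι₁ ι₂ ℚ}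
    (hPQ : P * Q = 1) {C : Matrix (ι₁ ⊕ ι₂) (ι₁ ⊕ ι₂) ℚ} :
    C ∈ hodgeGroupLieRat (prodPeriod Φ₁ Φ₂) ↔
      C.toBlocks₁₁ ∈ hodgeGroupLieRat Φ₁ ∧ C = fromBlocks C.toBlocks₁₁ 0 0 (P * C.toBlocks₁₁ * Q) := by
  constructor
  · intro hC
    refine ⟨toBlocks₁₁_mem_hodgeGroupLieRat Φ₁ Φ₂ hC, ?_⟩
    conv_lhs => rw [eq_fromBlocks_of_mem_hodgeGroupLieRat_prod Φ₁ Φ₂ hC,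
      toBlocks₂₂_eq_conj_of_mem_hodgeGroupLieRat_prod Φ₁ Φ₂ hC hP hPQ]
  · rintro ⟨hA, hCeq⟩
    obtain ⟨C', hC', hC'A⟩ := exists_mem_hodgeGroupLieRat_prod_toBlocks₁₁_eq Φ₁ Φ₂ hA
    have hC'eq := eq_fromBlocks_of_mem_hodgeGroupLieRat_prod Φ₁ Φ₂ hC'
    rw [toBlocks₂₂_eq_conj_of_mem_hodgeGroupLieRat_prod Φ₁ Φ₂ hC' hP hPQ, hC'A] at hC'eq
    rw [hCeq, ← hC'eq]
    exact hC'

/-- **`(A 0; 0 P A Q) ∈ 𝒜(X₁ × X₂)` for every `A ∈ 𝒜(X₁)`** (mutually inverse `P ∈ Hom_ℚ(X₁, X₂)`, `Q`). [cite: Imai1976HodgeGroups, §3 Remarks] -/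
theorem fromBlocks_conj_mem_hodgeGroupLieRat_prod {P : Matrix ι₂ ι₁ ℚ} (hP : P ∈ homRat Φ₁ Φ₂) {Q : Matrix ι₁ ι₂ ℚ}
    (hPQ : P * Q = 1) {A : Matrix ι₁ ι₁ ℚ} (hA : A ∈ hodgeGroupLieRat Φ₁) :
    fromBlocks A 0 0 (P * A * Q) ∈ hodgeGroupLieRat (prodPeriod Φ₁ Φ₂) :=
  (mem_hodgeGroupLieRat_prod_iff_of_homRat Φ₁ Φ₂ hP hPQ).2 ⟨by rw [toBlocks_fromBlocks₁₁]; exact hA, by simp⟩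

/-- **IMAI'S FORMULA OVER `ℚ` FOR ISOGENOUS COMPLEX TORI: `𝒜(X₁ × X₂) = {(A 0; 0 P A Q) | A ∈ 𝒜(X₁)}`** («`Hg(E₁ × E₂) = {(x, λxλ⁻¹) |
x ∈ Hg(E₁)}` where `λ : E₁ → E₂` is an isogeny», at the rational Lie algebra, for arbitrary tori). [cite: Imai1976HodgeGroups, §3 Remarks]
[cite: MoonenZarhin1999LowDim, (0.2)(4) and §1] -/
theorem coe_hodgeGroupLieRat_prod_eq_image_conj {P : Matrix ι₂ ι₁ ℚ} (hP : P ∈ homRat Φ₁ Φ₂) {Q : Matrix ι₁ ι₂ ℚ}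
    (hPQ : P * Q = 1) :
    (hodgeGroupLieRat (prodPeriod Φ₁ Φ₂) : Set (Matrix (ι₁ ⊕ ι₂) (ι₁ ⊕ ι₂) ℚ)) =
      (fun A : Matrix ι₁ ι₁ ℚ ↦ fromBlocks A 0 0 (P * A * Q)) '' (hodgeGroupLieRat Φ₁ : Set (Matrix ι₁ ι₁ ℚ)) := by
  ext C
  constructor
  · intro hC
    obtain ⟨hA, hCeq⟩ := (mem_hodgeGroupLieRat_prod_iff_of_homRat Φ₁ Φ₂ hP hPQ).1 hC
    exact ⟨C.toBlocks₁₁, hA, hCeq.symm⟩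
  · rintro ⟨A, hA, rfl⟩
    exact fromBlocks_conj_mem_hodgeGroupLieRat_prod Φ₁ Φ₂ hP hPQ hA

/-- **`r₁ : 𝒜(X₁ × X₂) ≅ 𝒜(X₁)` OVER `ℚ` when `Hom_ℚ(X₁, X₂)` contains a `P` with a right inverse** (`P Q = 1`: `X₂` is a quotient of
`X₁` up to isogeny; in particular for isogenous factors) — `C₂₂ = P C₁₁ Q` makes the onto projection `r₁` injective.
[cite: Imai1976HodgeGroups, §3 Remarks] [cite: MoonenZarhin1999LowDim, §1 ("identify `Hg(X₁^{n₁} × ⋯)` with `Hg(X₁ × ⋯)`")] -/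
theorem nonempty_lieEquiv_hodgeGroupLieRat_prod_left_of_right_inverse {P : Matrix ι₂ ι₁ ℚ} (hP : P ∈ homRat Φ₁ Φ₂)
    {Q : Matrix ι₁ ι₂ ℚ} (hPQ : P * Q = 1) :
    Nonempty (hodgeGroupLieRat (prodPeriod Φ₁ Φ₂) ≃ₗ⁅ℚ⁆ hodgeGroupLieRat Φ₁) := by
  obtain ⟨f, g, hf, -, hfs, -, -⟩ := exists_lieHom_toBlocks_rat Φ₁ Φ₂
  refine ⟨LieEquiv.ofBijective f ⟨fun C D hCD ↦ Subtype.ext ?_, hfs⟩⟩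
  have h₁ : (C : Matrix (ι₁ ⊕ ι₂) (ι₁ ⊕ ι₂) ℚ).toBlocks₁₁ = (D : Matrix (ι₁ ⊕ ι₂) (ι₁ ⊕ ι₂) ℚ).toBlocks₁₁ := by
    rw [← hf C, ← hf D, hCD]
  rw [((mem_hodgeGroupLieRat_prod_iff_of_homRat Φ₁ Φ₂ hP hPQ).1 C.2).2,
    ((mem_hodgeGroupLieRat_prod_iff_of_homRat Φ₁ Φ₂ hP hPQ).1 D.2).2, h₁]

/-- `dim_ℚ 𝒜(X₁ × X₂) = dim_ℚ 𝒜(X₁)` when some `P ∈ Hom_ℚ(X₁, X₂)` has a right inverse. [cite: MoonenZarhin1999LowDim, §1] [cite: Imai1976HodgeGroups, §3 Remarks] -/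
theorem finrank_hodgeGroupLieRat_prod_eq_left_of_right_inverse {P : Matrix ι₂ ι₁ ℚ} (hP : P ∈ homRat Φ₁ Φ₂)
    {Q : Matrix ι₁ ι₂ ℚ} (hPQ : P * Q = 1) :
    finrank ℚ (hodgeGroupLieRat (prodPeriod Φ₁ Φ₂)) = finrank ℚ (hodgeGroupLieRat Φ₁) := by
  obtain ⟨e⟩ := nonempty_lieEquiv_hodgeGroupLieRat_prod_left_of_right_inverse Φ₁ Φ₂ hP hPQ
  exact e.toLinearEquiv.finrank_eq

variable {Φ₁ Φ₂} in
/-- **ISOGENOUS FACTORS: `𝒜(X₁ × X₂) ≅ 𝒜(X₁)` over `ℚ`** («we can identify `Hg(X²)` with `Hg(X)`, acting diagonally», twisted by the isogeny).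
[cite: MoonenZarhin1999LowDim, (0.2)(4) and §1] [cite: Imai1976HodgeGroups, §3 Remarks] [cite: Lange2023AbelianVarietiesComplex, §1.1.2 Prop. 1.1.15] -/
theorem IsIsogenous.nonempty_lieEquiv_hodgeGroupLieRat_prod (hiso : IsIsogenous Φ₁ Φ₂) :
    Nonempty (hodgeGroupLieRat (prodPeriod Φ₁ Φ₂) ≃ₗ⁅ℚ⁆ hodgeGroupLieRat Φ₁) := by
  obtain ⟨A, hA⟩ := hiso
  obtain ⟨Q, -, -, hAQ⟩ := hA.exists_homRat_inverse
  exact nonempty_lieEquiv_hodgeGroupLieRat_prod_left_of_right_inverse Φ₁ Φ₂ hA.map_intCast_mem_homRat hAQ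

variable {Φ₁ Φ₂} in
/-- **ISOGENOUS FACTORS: `dim_ℚ 𝒜(X₁ × X₂) = dim_ℚ 𝒜(X₁) = dim_ℚ 𝒜(X₂)`** (`dim Hg(X₁ × X₂) = dim Hg(X₁)`).
[cite: MoonenZarhin1999LowDim, (0.2)(4) and §1] [cite: Imai1976HodgeGroups, §3 Remarks] -/
theorem IsIsogenous.finrank_hodgeGroupLieRat_prod_eq (hiso : IsIsogenous Φ₁ Φ₂) :
    finrank ℚ (hodgeGroupLieRat (prodPeriod Φ₁ Φ₂)) = finrank ℚ (hodgeGroupLieRat Φ₁) ∧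
      finrank ℚ (hodgeGroupLieRat (prodPeriod Φ₁ Φ₂)) = finrank ℚ (hodgeGroupLieRat Φ₂) := by
  obtain ⟨e⟩ := hiso.nonempty_lieEquiv_hodgeGroupLieRat_prod
  exact ⟨e.toLinearEquiv.finrank_eq, e.toLinearEquiv.finrank_eq.trans hiso.finrank_hodgeGroupLieRat_eq⟩

variable {Φ₁ Φ₂} in
/-- Imai's formula for an isogeny `ρ(A) : X₁ → X₂` with `ℚ`-inverse `Q`: `𝒜(X₁ × X₂) = {(B 0; 0 A B Q) | B ∈ 𝒜(X₁)}`.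
[cite: Imai1976HodgeGroups, §3 Remarks] [cite: Lange2023AbelianVarietiesComplex, §1.1.2 Prop. 1.1.15] -/
theorem IsIsogeny.coe_hodgeGroupLieRat_prod_eq_image_conj {A : Matrix ι₂ ι₁ ℤ} (hA : IsIsogeny Φ₁ Φ₂ A) {Q : Matrix ι₁ ι₂ ℚ}
    (hAQ : A.map (Int.cast : ℤ → ℚ) * Q = 1) :
    (hodgeGroupLieRat (prodPeriod Φ₁ Φ₂) : Set (Matrix (ι₁ ⊕ ι₂) (ι₁ ⊕ ι₂) ℚ)) =
      (fun B : Matrix ι₁ ι₁ ℚ ↦ fromBlocks B 0 0 (A.map (Int.cast : ℤ → ℚ) * B * Q)) '' (hodgeGroupLieRat Φ₁ : Set (Matrix ι₁ ι₁ ℚ)) :=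
  ComplexTorus.coe_hodgeGroupLieRat_prod_eq_image_conj Φ₁ Φ₂ hA.map_intCast_mem_homRat hAQ

/-! ### §4 Embedded factors: an injective `P ∈ Hom_ℚ(X₁, X₂)` (`Q P = 1`) gives `r₂ : 𝒜(X₁ × X₂) ≅ 𝒜(X₂)` and `𝔤₁(ℚ) = 0` -/

/-- **`X₁` ISOGENOUS ONTO A SUBTORUS OF `X₂` (`Q P = 1` for some `P ∈ Hom_ℚ(X₁, X₂)`) ⟹ `r₂ : 𝒜(X₁ × X₂) ≅ 𝒜(X₂)` OVER `ℚ`**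
(`C₁₁ = Q C₂₂ P` makes the onto projection `r₂` injective; «`Hg(Y × X) = Hg(X)` for a factor `Y` of `X`», infinitesimally over `ℚ`).
[cite: MoonenZarhin1999LowDim, (0.2)(4) and §1] [cite: Imai1976HodgeGroups, §3 Remarks] -/
theorem nonempty_lieEquiv_hodgeGroupLieRat_prod_right_of_left_inverse {P : Matrix ι₂ ι₁ ℚ} (hP : P ∈ homRat Φ₁ Φ₂)
    {Q : Matrix ι₁ ι₂ ℚ} (hQP : Q * P = 1) :
    Nonempty (hodgeGroupLieRat (prodPeriod Φ₁ Φ₂) ≃ₗ⁅ℚ⁆ hodgeGroupLieRat Φ₂) := by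
  obtain ⟨f, g, -, hg, -, hgs, -⟩ := exists_lieHom_toBlocks_rat Φ₁ Φ₂
  refine ⟨LieEquiv.ofBijective g ⟨fun C D hCD ↦ Subtype.ext ?_, hgs⟩⟩
  have h₂ : (C : Matrix (ι₁ ⊕ ι₂) (ι₁ ⊕ ι₂) ℚ).toBlocks₂₂ = (D : Matrix (ι₁ ⊕ ι₂) (ι₁ ⊕ ι₂) ℚ).toBlocks₂₂ := by
    rw [← hg C, ← hg D, hCD]
  have h₁ : (C : Matrix (ι₁ ⊕ ι₂) (ι₁ ⊕ ι₂) ℚ).toBlocks₁₁ = (D : Matrix (ι₁ ⊕ ι₂) (ι₁ ⊕ ι₂) ℚ).toBlocks₁₁ := by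
    rw [toBlocks₁₁_eq_of_mem_hodgeGroupLieRat_prod_of_left_inverse Φ₁ Φ₂ C.2 hP hQP,
      toBlocks₁₁_eq_of_mem_hodgeGroupLieRat_prod_of_left_inverse Φ₁ Φ₂ D.2 hP hQP, h₂]
  rw [eq_fromBlocks_of_mem_hodgeGroupLieRat_prod Φ₁ Φ₂ C.2, eq_fromBlocks_of_mem_hodgeGroupLieRat_prod Φ₁ Φ₂ D.2, h₁, h₂]

/-- `dim_ℚ 𝒜(X₁ × X₂) = dim_ℚ 𝒜(X₂)` when some `P ∈ Hom_ℚ(X₁, X₂)` has a left inverse. [cite: MoonenZarhin1999LowDim, §1] -/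
theorem finrank_hodgeGroupLieRat_prod_eq_right_of_left_inverse {P : Matrix ι₂ ι₁ ℚ} (hP : P ∈ homRat Φ₁ Φ₂)
    {Q : Matrix ι₁ ι₂ ℚ} (hQP : Q * P = 1) :
    finrank ℚ (hodgeGroupLieRat (prodPeriod Φ₁ Φ₂)) = finrank ℚ (hodgeGroupLieRat Φ₂) := by
  obtain ⟨e⟩ := nonempty_lieEquiv_hodgeGroupLieRat_prod_right_of_left_inverse Φ₁ Φ₂ hP hQP
  exact e.toLinearEquiv.finrank_eq

/-- With an injective `P ∈ Hom_ℚ(X₁, X₂)` (`Q P = 1`): `𝔤₁(ℚ) = 0`, i.e. `(A 0; 0 0) ∈ 𝒜(X₁ × X₂) ⟹ A = 0` — no part of `Hg(X₁)` acts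
independently of `X₂`. [cite: MoonenZarhin1999LowDim, §3 (3.1) and §1] -/
theorem eq_zero_of_fromBlocks_zero_mem_of_left_inverse {P : Matrix ι₂ ι₁ ℚ} (hP : P ∈ homRat Φ₁ Φ₂) {Q : Matrix ι₁ ι₂ ℚ}
    (hQP : Q * P = 1) {A : Matrix ι₁ ι₁ ℚ} (hA : fromBlocks A 0 0 (0 : Matrix ι₂ ι₂ ℚ) ∈ hodgeGroupLieRat (prodPeriod Φ₁ Φ₂)) :
    A = 0 := by
  have h := toBlocks₁₁_eq_of_mem_hodgeGroupLieRat_prod_of_left_inverse Φ₁ Φ₂ hA hP hQP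
  rwa [toBlocks_fromBlocks₁₁, toBlocks_fromBlocks₂₂, Matrix.mul_zero, Matrix.zero_mul] at h

/-- With a surjective `P ∈ Hom_ℚ(X₁, X₂)` (`P Q = 1`): `𝔤₂(ℚ) = 0`, i.e. `(0 0; 0 B) ∈ 𝒜(X₁ × X₂) ⟹ B = 0`.
[cite: MoonenZarhin1999LowDim, §3 (3.1) and §1] -/
theorem eq_zero_of_zero_fromBlocks_mem_of_right_inverse {P : Matrix ι₂ ι₁ ℚ} (hP : P ∈ homRat Φ₁ Φ₂) {Q : Matrix ι₁ ι₂ ℚ}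
    (hPQ : P * Q = 1) {B : Matrix ι₂ ι₂ ℚ} (hB : fromBlocks (0 : Matrix ι₁ ι₁ ℚ) 0 0 B ∈ hodgeGroupLieRat (prodPeriod Φ₁ Φ₂)) :
    B = 0 := by
  have h := toBlocks₂₂_eq_conj_of_mem_hodgeGroupLieRat_prod Φ₁ Φ₂ hB hP hPQ
  rwa [toBlocks_fromBlocks₁₁, toBlocks_fromBlocks₂₂, Matrix.mul_zero, Matrix.zero_mul] at h

end ComplexTorus

end Literature.Geometry.Kaehler
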